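import Literature.AlgebraicGeometry.Frobenioids.EquivalenceThm34OfThm34ii
import Literature.AlgebraicGeometry.Frobenioids.CategoryTheoreticityFacts
import Literature.AlgebraicGeometry.Frobenioids.Thm34vSlim
import Literature.AnabelianGeometry.EtaleTheta.Discharge.Sec3Cor38Rows
import Literature.AnabelianGeometry.EtaleTheta.Discharge.Sec3Cor38Hull
import Literature.AnabelianGeometry.EtaleTheta.Discharge.Sec3Cor38HullObjects
import Literature.AnabelianGeometry.EtaleTheta.Discharge.Sec3Cor38StdIsoNotGL
import Literature.AnabelianGeometry.EtaleTheta.Discharge.Sec3Cor38PerfectionR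
import Literature.AnabelianGeometry.EtaleTheta.Discharge.Sec3Cor38PerfectionMapTransport
import Literature.AnabelianGeometry.EtaleTheta.Discharge.Sec3Remark363
import Literature.AnabelianGeometry.EtaleTheta.Discharge.Sec3Thm37Holds
import HarnessLib

/-!
# [EtTh] Corollary 3.8, proof rows C38-L07, L09, L10 (+ L02a, L04, L06, L08) ASSEMBLED from the tree's PROVED
# [FrdI] Thm. 3.4; Cor. 3.8 (i) modulo the criterion C38-L05 only, Cor. 3.8 (ii) over slim bases

S. Mochizuki, *The étale theta function …*, Publ. RIMS **45** (2009), Cor. 3.8, statement PDF pp. 80–81, proof PDF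
pp. 81–82 [cite: MochizukiEtTh2009, Cor 3.8 p.81]; S. Mochizuki, *The geometry of Frobenioids I*, Thm. 3.4 (ii)–(v)
pp. 62–63 [cite: MochizukiFrdI2008, Thm. 3.4 (ii) p.62].

PROOF-ONLY companion (abc-iut cell, block F, seat abc-iut-f-034; FACT-LIST rows **F-2818** `Cor38Hyp.PreservesFactorisation`,
**F-2821** `Cor38Hyp.PreservesFrobeniusTrivial`, **F-2823** `Cor38Hyp.InducesHullEquivalence`) of abc-iut-w5-d124's
sub-DAG `TemperedFrobenioidCor38Sub.lean` and of the L2 row-dischargers (`Sec3Cor38Rows`, `Sec3Cor38Hull`,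
`Sec3Cor38HullObjects`, `Sec3Cor38StdIsoNotGL`, `Sec3Cor38PerfectionR`, `Sec3Cor38PerfectionMapTransport`,
`Sec3Remark363`; cf. abc-iut-w6-d039's node-level `Sec3Cor38iAssembly`, abc-iut-f-001's `Sec3Cor38Thm34RowsTreeVocab`
for rows F-2809/2812/2815/2816). As there, every "[Mzk17], Theorem 3.4" input of the printed proof flows from the ONE
0-ary named fact `h34 := FrdI.Thm34ii` ([FrdI] Thm. 3.4 (ii), 2008 wording, FACT F-0711 — a THEOREM of the tree,
`FrdI.Thm34ii_holds`, taken BY NAME as a binder while that module's olean is not served; (iii), (iv), (v) are its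
PROVED consequences `FrdI.thm34iii_ofFunctor_of_thm34ii`, `FrdI.thm34iv_ofFunctor_of_thm34ii`,
`PreFrobenioid.thm34v_conclusion_of_preserves_baseIso`). The rows then close for EVERY pair of tempered Frobenioids
with data `h : Cor38Hyp C₁ C₂` whose model categories are Frobenioids (`hF_i`, [FrdI] Thm. 5.2 (ii); at the canonical
vocabulary: abc-iut-L2's standing residual `hBmon_i : IsMonoidOn B_i`) and which satisfy C38-L01 (`H`; at the
canonical vocabulary: `standardIsotropicNotGroupLike_treeCatVocab`):
* C38-L02a `preservesPreSteps_of_isFrobenioid`; C38-L07 = **F-2818** `preservesFactorisation_of_isFrobenioid`;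
  `preservesLinear_of_isFrobenioid`; C38-L04 (i) `preservesOTri_of_isFrobeniusSlim` (`D_i` Frobenius-slim);
* the base squares of [FrdI] Cor. 4.11 (ii) over SLIM bases `baseSquare_of_isSlim` ([FrdI] Rem. 4.11.1: the slim case
  is Thm. 3.4 (v)); C38-L04 (ii) `preservesOTri_of_isSlim`;
* C38-L09 = **F-2821** `preservesFrobeniusTrivial_of_isSlim` (print: "`D_i` Div-slim"; slim ⇒ Div-slim),
  `…_of_cor411ii` (Div-slim, GIVEN the typed [FrdI] Cor. 4.11 (ii) for `Ψ`, `Ψ⁻¹` by name), `…_of_baseSquares`;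
* C38-L06/L08 `preservesBsFldPreSteps_…`, `preservesBaseFieldTheoretic_…` GIVEN the intrinsic criterion C38-L05
  `BsFldPreStepLimitCriterion` at THE perfections (the one row of the sub-DAG not discharged in the tree);
* C38-L10 = **F-2823** `inducesHullEquivalence_of_isSlim_of_criterion` (+ Rmk. 3.6.3 `Remark363` by name);
* the typed **Cor. 3.8 (i)** `cor38_i_of_criterion` (modulo `h34`, `hF_i`, `H`, C38-L05 only) and **Cor. 3.8 (ii)**
  over slim bases `cor38_ii_of_isSlim_of_criterion` (modulo additionally Rmk. 3.6.3); `…_treeCatVocab` variants.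

R1 triage of the three FACT rows: SCHEMATA over `h : Cor38Hyp C₁ C₂` for tempered-Frobenioid DATA over arbitrary
[FrdI] vocabularies `V`, `VD` (junk vocabularies admit data whose model category is not a Frobenioid); the instance
forms the printed proof asserts are the theorems below. No definition; nothing of either paper restated or
strengthened; refereed pre-IUT material — nothing here bears on [IUTchIII] Cor. 3.12; typed ≠ proved.
-/

namespace Literature.AnabelianGeometry.EtaleTheta

open CategoryTheory Opposite Literature.AlgebraicGeometry.Frobenioids

universe u₀ v₀ u v w u₁ v₁

section General

variable {D₀ : Type u₀} [Category.{v₀} D₀] {D₀' : Type u₀} [Category.{v₀} D₀'] {V : FrdIMonoidStub.{w}}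
  {T : RealifiedDivisorMonoids (D₀ := D₀) V} {T' : RealifiedDivisorMonoids (D₀ := D₀') V}
  {D : Type u} [Category.{v} D] {D' : Type u} [Category.{v} D']
  {VD : FrdICatStub.{u, v, w} D} {VD' : FrdICatStub.{u, v, w} D'}
  {C₁ : TemperedFrobenioid T D VD} {C₂ : TemperedFrobenioid T' D' VD'} (h : Cor38Hyp C₁ C₂)
  (h34 : FrdI.Thm34ii.{w, v, max v w, u, max u w})

namespace Cor38Hyp

include h34

/-- **C38-L02a DISCHARGED** (proof of Cor. 3.8, p.81 l.2–3: "by [Mzk17], Theorem 3.4, (ii) … `Ψ` preserves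
pre-steps"): for tempered Frobenioids whose model categories are Frobenioids and which satisfy C38-L01, `Ψ` and
`Ψ⁻¹` preserve pre-steps — [FrdI] Thm. 3.4 (ii) in its PRINTED 2008 wording (`FrdI.thm34ii_ofFunctor`,
abc-iut-L1-t11/t13), quasi-isotropic type being clause (a) of standard type and "`D_i` of FSMFF-type" the field
`h.fsmff`. [cite: MochizukiEtTh2009, Cor 3.8 p.81] -/
theorem preservesPreSteps_of_isFrobenioid (hF₁ : PreFrobenioid.IsFrobenioid C₁.toElem)
    (hF₂ : PreFrobenioid.IsFrobenioid C₂.toElem) (H : h.StandardIsotropicNotGroupLike) :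
    h.PreservesPreSteps :=
  h.preservesPreSteps_of_thm34ii (h34 _ _ hF₁ hF₂ h.Ψ) (h34 _ _ hF₂ hF₁ h.Ψ.symm)
    H.standard.1.quasiIsotropic H.standard.2.quasiIsotropic

/-- [FrdI] Thm. 3.4 (iii) (morphisms-and-degrees part, 2008 wording, `FrdI.Thm34iii_holds`) AT the operations of
the two tempered Frobenioids, for `Ψ`. [cite: MochizukiFrdI2008, Thm. 3.4 (iii) p.62] -/
theorem thm34iii_opsData (hF₁ : PreFrobenioid.IsFrobenioid C₁.toElem)
    (hF₂ : PreFrobenioid.IsFrobenioid C₂.toElem) : C₁.opsData.Thm34iii C₂.opsData h.Ψ :=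
  FrdI.thm34iii_ofFunctor_of_thm34ii hF₁ hF₂ h.Ψ (h34 _ _ hF₁ hF₂ h.Ψ) (h34 _ _ hF₂ hF₁ h.Ψ.symm)

/-- … and for `Ψ⁻¹`. [cite: MochizukiFrdI2008, Thm. 3.4 (iii) p.62] -/
theorem thm34iii_opsData_symm (hF₁ : PreFrobenioid.IsFrobenioid C₁.toElem)
    (hF₂ : PreFrobenioid.IsFrobenioid C₂.toElem) : C₂.opsData.Thm34iii C₁.opsData h.Ψ.symm :=
  FrdI.thm34iii_ofFunctor_of_thm34ii hF₂ hF₁ h.Ψ.symm (h34 _ _ hF₂ hF₁ h.Ψ.symm) (h34 _ _ hF₁ hF₂ h.Ψ)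

/-- [FrdI] Thm. 3.4 (iv) (preservation part, 2008 wording, `FrdI.Thm34iv_holds`) AT the operations of the two
tempered Frobenioids, for `Ψ`. [cite: MochizukiFrdI2008, Thm. 3.4 (iv) p.63] -/
theorem thm34iv_opsData (hF₁ : PreFrobenioid.IsFrobenioid C₁.toElem)
    (hF₂ : PreFrobenioid.IsFrobenioid C₂.toElem) : C₁.opsData.Thm34iv C₂.opsData h.Ψ :=
  FrdI.thm34iv_ofFunctor_of_thm34ii hF₁ hF₂ h.Ψ (h34 _ _ hF₁ hF₂ h.Ψ) (h34 _ _ hF₂ hF₁ h.Ψ.symm)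

/-- … and for `Ψ⁻¹`. [cite: MochizukiFrdI2008, Thm. 3.4 (iv) p.63] -/
theorem thm34iv_opsData_symm (hF₁ : PreFrobenioid.IsFrobenioid C₁.toElem)
    (hF₂ : PreFrobenioid.IsFrobenioid C₂.toElem) : C₂.opsData.Thm34iv C₁.opsData h.Ψ.symm :=
  FrdI.thm34iv_ofFunctor_of_thm34ii hF₂ hF₁ h.Ψ.symm (h34 _ _ hF₂ hF₁ h.Ψ.symm) (h34 _ _ hF₁ hF₂ h.Ψ)

/-- **C38-L07 = FACT F-2818 `PreservesFactorisation`, instance form PROVED** (p.81 l.15–18: "`Ψ` preserves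
[cf. [Mzk17], Theorem 3.4, (ii), (iii)] the factorization … into a composite of a morphism of Frobenius type, a
pre-step, and a pull-back morphism"): for every pair of tempered Frobenioids whose model categories are
Frobenioids, satisfying C38-L01, and every `Ψ` in `Cor38Hyp`, `Ψ` and `Ψ⁻¹` carry morphisms of Frobenius
type, pre-steps and pull-back morphisms to such — Thm. 3.4 (ii)/(iii) as printed, hypothesis (b) being vacuous
(`C_i` not of group-like type, Thm. 3.7 (i)). [cite: MochizukiEtTh2009, Cor 3.8 p.81] -/
theorem preservesFactorisation_of_isFrobenioid (hF₁ : PreFrobenioid.IsFrobenioid C₁.toElem)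
    (hF₂ : PreFrobenioid.IsFrobenioid C₂.toElem) (H : h.StandardIsotropicNotGroupLike) :
    h.PreservesFactorisation :=
  h.preservesFactorisation_of_thm34 (h.preservesPreSteps_of_isFrobenioid h34 hF₁ hF₂ H)
    (h.thm34iii_opsData h34 hF₁ hF₂) (h.thm34iii_opsData_symm h34 hF₁ hF₂) H
    (h.hypB_of_standardIsotropicNotGroupLike H) (h.hypB_symm_of_standardIsotropicNotGroupLike H)

/-- "`Ψ` preserves linear morphisms" (the degree half of "`Ψ` preserves `O^▷(−)`", p.81; [FrdI] Thm. 3.4 (iii)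
as printed), for `Ψ` and `Ψ⁻¹`, modulo `hF_i` and C38-L01. [cite: MochizukiEtTh2009, Cor 3.8 p.81] -/
theorem preservesLinear_of_isFrobenioid (hF₁ : PreFrobenioid.IsFrobenioid C₁.toElem)
    (hF₂ : PreFrobenioid.IsFrobenioid C₂.toElem) (H : h.StandardIsotropicNotGroupLike) :
    h.PreservesLinear :=
  h.preservesLinear_of_thm34iii (h.thm34iii_opsData h34 hF₁ hF₂) (h.thm34iii_opsData_symm h34 hF₁ hF₂) H
    (h.hypB_of_standardIsotropicNotGroupLike H) (h.hypB_symm_of_standardIsotropicNotGroupLike H)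

/-- **C38-L04, CASE (i), DISCHARGED** (p.81 l.5–8: "By applying [Mzk17], Theorem 3.4, (iv), in the case of
assertion (i) … `Ψ` preserves the submonoids '`O^▷(−)`'"): for `D₁`, `D₂` Frobenius-slim (the hypothesis of
Cor. 3.8 (i)), `Ψ` and `Ψ⁻¹` preserve `O^▷(−)` — Thm. 3.4 (iv) as printed (`FrdI.Thm34iv_holds`), modulo
`hF_i` and C38-L01. [cite: MochizukiEtTh2009, Cor 3.8 p.81] -/
theorem preservesOTri_of_isFrobeniusSlim (hF₁ : PreFrobenioid.IsFrobenioid C₁.toElem)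
    (hF₂ : PreFrobenioid.IsFrobenioid C₂.toElem) (H : h.StandardIsotropicNotGroupLike)
    (hFs : IsFrobeniusSlim D) (hFs' : IsFrobeniusSlim D') : h.PreservesOTri :=
  h.preservesOTri_of_thm34iv (h.thm34iv_opsData h34 hF₁ hF₂) (h.thm34iv_opsData_symm h34 hF₁ hF₂) H
    (h.hypB_of_standardIsotropicNotGroupLike H) (h.hypB_symm_of_standardIsotropicNotGroupLike H) hFs hFs'

/-- **The base squares of [FrdI] Cor. 4.11 (ii) for `Ψ` and `Ψ⁻¹` over SLIM bases** (the case of Cor. 3.8 (ii)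
in which "`D_i` Div-slim" holds because `D_i` is slim, [FrdI] Def. 4.5 (iv); by [FrdI] Rem. 4.11.1 this case of
Cor. 4.11 (ii) is Thm. 3.4 (v)): `Ψ`, `Ψ⁻¹` preserve base-isomorphisms by Thm. 3.4 (iii) as printed, then
abc-iut-L1-d4's `thm34v_conclusion_of_preserves_baseIso`. Modulo `hF_i` and C38-L01.
[cite: MochizukiFrdI2008, Thm. 3.4 (v) p.63] -/
theorem baseSquare_of_isSlim (hF₁ : PreFrobenioid.IsFrobenioid C₁.toElem)
    (hF₂ : PreFrobenioid.IsFrobenioid C₂.toElem) (H : h.StandardIsotropicNotGroupLike)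
    (hs₁ : IsSlim D) (hs₂ : IsSlim D') : h.BaseSquare ∧ h.BaseSquareInv := by
  obtain ⟨hmor, -⟩ := h.thm34iii_opsData h34 hF₁ hF₂ H.standard.1 H.standard.2
    (h.hypB_of_standardIsotropicNotGroupLike H)
  obtain ⟨hmor', -⟩ := h.thm34iii_opsData_symm h34 hF₁ hF₂ H.standard.2 H.standard.1
    (h.hypB_symm_of_standardIsotropicNotGroupLike H)
  have hbi : ∀ ⦃X Y : C₁.category⦄ (f : X ⟶ Y), IsIso (PreFrobenioid.Base C₁.toElem f) →
      IsIso (PreFrobenioid.Base C₂.toElem (h.Ψ.functor.map f)) := fun X Y f hf => hmor.2.2.1 f hf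
  have hbi' : ∀ ⦃X Y : C₂.category⦄ (f : X ⟶ Y), IsIso (PreFrobenioid.Base C₂.toElem f) →
      IsIso (PreFrobenioid.Base C₁.toElem (h.Ψ.inverse.map f)) := fun X Y f hf => hmor'.2.2.1 f hf
  obtain ⟨-, -, ΨB, hsq, -, -⟩ :=
    PreFrobenioid.thm34v_conclusion_of_preserves_baseIso hF₁ hF₂ h.Ψ hs₁ hs₂ hbi hbi'
  obtain ⟨-, -, ΨB', hsq', -, -⟩ :=
    PreFrobenioid.thm34v_conclusion_of_preserves_baseIso hF₂ hF₁ h.Ψ.symm hs₂ hs₁ hbi' hbi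
  exact ⟨⟨ΨB, hsq⟩, ⟨ΨB', hsq'⟩⟩

/-- **C38-L04, CASE (ii), over slim bases** (p.81 l.5–8: "[Mzk17], Theorem 3.4, (ii); [Mzk17], Corollary 4.11,
(ii), in the case of assertion (ii)"): `Ψ` and `Ψ⁻¹` preserve `O^▷(−)` — the base squares of Cor. 4.11 (ii)
(slim case) and the preservation of linear morphisms. Modulo `hF_i` and C38-L01.
[cite: MochizukiEtTh2009, Cor 3.8 p.81] -/
theorem preservesOTri_of_isSlim (hF₁ : PreFrobenioid.IsFrobenioid C₁.toElem)
    (hF₂ : PreFrobenioid.IsFrobenioid C₂.toElem) (H : h.StandardIsotropicNotGroupLike)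
    (hs₁ : IsSlim D) (hs₂ : IsSlim D') : h.PreservesOTri :=
  h.preservesOTri_of_baseSquare (h.baseSquare_of_isSlim h34 hF₁ hF₂ H hs₁ hs₂).1
    (h.baseSquare_of_isSlim h34 hF₁ hF₂ H hs₁ hs₂).2 (h.preservesLinear_of_isFrobenioid h34 hF₁ hF₂ H)

/-- **C38-L09 = FACT F-2821 `PreservesFrobeniusTrivial`, instance form PROVED over slim bases** (p.81 l.20 –
p.82 l.1: "under the assumptions of assertion (ii), `Ψ` preserves [cf. [Mzk17], Theorem 3.4, (iii); [Mzk17],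
Corollary 4.11, (ii)] the Frobenius-trivial objects"): for every pair of tempered Frobenioids over SLIM base
categories whose model categories are Frobenioids, satisfying C38-L01, and every `Ψ` in `Cor38Hyp`, `Ψ` and
`Ψ⁻¹` carry Frobenius-trivial objects to Frobenius-trivial objects — abc-iut-w5-d124's derivation
`preservesFrobeniusTrivial_of_inputs` with ALL its inputs discharged (base squares: slim case of Cor. 4.11 (ii);
Thm. 3.4 (iii) as printed; hypothesis (b) vacuous). Print's hypothesis is "`D_i` Div-slim"; slim ⇒ Div-slim
([FrdI] Def. 4.5 (iv)), the general Div-slim case is `preservesFrobeniusTrivial_of_cor411ii`.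
[cite: MochizukiEtTh2009, Cor 3.8 p.82] -/
theorem preservesFrobeniusTrivial_of_isSlim (hF₁ : PreFrobenioid.IsFrobenioid C₁.toElem)
    (hF₂ : PreFrobenioid.IsFrobenioid C₂.toElem) (H : h.StandardIsotropicNotGroupLike)
    (hs₁ : IsSlim D) (hs₂ : IsSlim D') : h.PreservesFrobeniusTrivial :=
  h.preservesFrobeniusTrivial_of_inputs (h.baseSquare_of_isSlim h34 hF₁ hF₂ H hs₁ hs₂).1
    (h.baseSquare_of_isSlim h34 hF₁ hF₂ H hs₁ hs₂).2 (h.thm34iii_opsData h34 hF₁ hF₂)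
    (h.thm34iii_opsData_symm h34 hF₁ hF₂) H (h.hypB_of_standardIsotropicNotGroupLike H)
    (h.hypB_symm_of_standardIsotropicNotGroupLike H)

/-- **C38-L09 = FACT F-2821, instance form over Div-slim bases GIVEN [FrdI] Cor. 4.11 (ii) by name**: for
`D₁`, `D₂` Div-slim (the printed hypothesis of Cor. 3.8 (ii)) and the typed per-instance [FrdI] Cor. 4.11 (ii)
(`PreFrobenioidData.Cor411ii`, FACT F-1026) for `Ψ` and `Ψ⁻¹`, `Ψ` and `Ψ⁻¹` preserve the Frobenius-trivial
objects; Thm. 3.4 (iii) as printed and the vacuity of hypothesis (b) are discharged here. Modulo `hF_i` and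
C38-L01. [cite: MochizukiEtTh2009, Cor 3.8 p.82] -/
theorem preservesFrobeniusTrivial_of_cor411ii (hF₁ : PreFrobenioid.IsFrobenioid C₁.toElem)
    (hF₂ : PreFrobenioid.IsFrobenioid C₂.toElem) (H : h.StandardIsotropicNotGroupLike)
    (hds : C₁.opsData.IsDivSlim ∧ C₂.opsData.IsDivSlim)
    (h411 : C₁.opsData.Cor411ii C₂.opsData h.Ψ) (h411' : C₂.opsData.Cor411ii C₁.opsData h.Ψ.symm) :
    h.PreservesFrobeniusTrivial :=
  h.preservesFrobeniusTrivial_of_inputs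
    (h.baseSquare_of_cor411ii h411 hds H (h.hypB_of_standardIsotropicNotGroupLike H))
    (h.baseSquareInv_of_cor411ii h411' hds H (h.hypB_symm_of_standardIsotropicNotGroupLike H))
    (h.thm34iii_opsData h34 hF₁ hF₂) (h.thm34iii_opsData_symm h34 hF₁ hF₂) H
    (h.hypB_of_standardIsotropicNotGroupLike H) (h.hypB_symm_of_standardIsotropicNotGroupLike H)

/-- **C38-L09 = FACT F-2821, instance form GIVEN the two base squares by name** (rows F-2813/F-2814
`BaseSquare`/`BaseSquareInv`, e.g. abc-iut-f-001's `baseSquare_treeCatVocab_of_isOfFSMType` over FSM-type bases):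
Thm. 3.4 (iii) as printed and the vacuity of hypothesis (b) are discharged here. Modulo `h34`, `hF_i`, C38-L01.
[cite: MochizukiEtTh2009, Cor 3.8 p.82] -/
theorem preservesFrobeniusTrivial_of_baseSquares (hF₁ : PreFrobenioid.IsFrobenioid C₁.toElem)
    (hF₂ : PreFrobenioid.IsFrobenioid C₂.toElem) (H : h.StandardIsotropicNotGroupLike)
    (hsq : h.BaseSquare) (hsq' : h.BaseSquareInv) : h.PreservesFrobeniusTrivial :=
  h.preservesFrobeniusTrivial_of_inputs hsq hsq' (h.thm34iii_opsData h34 hF₁ hF₂)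
    (h.thm34iii_opsData_symm h34 hF₁ hF₂) H (h.hypB_of_standardIsotropicNotGroupLike H)
    (h.hypB_symm_of_standardIsotropicNotGroupLike H)

end Cor38Hyp

end General

section TreeMonoidVocab

variable {D₀ : Type u₀} [Category.{v₀} D₀] {D₀' : Type u₀} [Category.{v₀} D₀']
  {T : RealifiedDivisorMonoids (D₀ := D₀) treeMonoidVocab.{w}}
  {T' : RealifiedDivisorMonoids (D₀ := D₀') treeMonoidVocab.{w}}
  {D : Type u} [Category.{v} D] {D' : Type u} [Category.{v} D']
  {VD : FrdICatStub.{u, v, w} D} {VD' : FrdICatStub.{u, v, w} D'}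
  {C₁ : TemperedFrobenioid T D VD} {C₂ : TemperedFrobenioid T' D' VD'} (h : Cor38Hyp C₁ C₂)
  (h34 : FrdI.Thm34ii.{w, v, max v w, u, max u w})

namespace Cor38Hyp

include h34

/-- **C38-L06, case (i)** (p.81 l.14–15: "Thus, `Ψ` preserves the base-field-theoretic pre-steps"), for `D₁`,
`D₂` Frobenius-slim, GIVEN the intrinsic criterion C38-L05 at THE perfections of `C₁`, `C₂`
(`BsFldPreStepLimitCriterion (perfection hF_i)`) — abc-iut-w5's transport `preservesBsFldPreSteps_of_C_rows`
with C38-L02a and C38-L04 (i) discharged. Modulo `hF_i` and C38-L01. [cite: MochizukiEtTh2009, Cor 3.8 p.81] -/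
theorem preservesBsFldPreSteps_of_isFrobeniusSlim_of_criterion (hF₁ : PreFrobenioid.IsFrobenioid C₁.toElem)
    (hF₂ : PreFrobenioid.IsFrobenioid C₂.toElem) (H : h.StandardIsotropicNotGroupLike)
    (hFs : IsFrobeniusSlim D) (hFs' : IsFrobeniusSlim D')
    (h5₁ : C₁.BsFldPreStepLimitCriterion (PreFrobenioidData.perfection hF₁))
    (h5₂ : C₂.BsFldPreStepLimitCriterion (PreFrobenioidData.perfection hF₂)) :
    h.PreservesBsFldPreSteps :=
  have hps := h.preservesPreSteps_of_isFrobenioid h34 hF₁ hF₂ H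
  h.preservesBsFldPreSteps_of_C_rows hF₁ hF₂ (h.isFrobeniusCompatible_of_preservesPreSteps hF₁ hF₂ hps)
    (h.isFrobeniusCompatible_inverse_of_preservesPreSteps hF₁ hF₂ hps) hps
    (h.preservesOTri_of_isFrobeniusSlim h34 hF₁ hF₂ H hFs hFs') h5₁ h5₂

/-- **C38-L06, case (ii), over slim bases**, GIVEN the criterion C38-L05 at THE perfections. Modulo `hF_i` and
C38-L01. [cite: MochizukiEtTh2009, Cor 3.8 p.81] -/
theorem preservesBsFldPreSteps_of_isSlim_of_criterion (hF₁ : PreFrobenioid.IsFrobenioid C₁.toElem)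
    (hF₂ : PreFrobenioid.IsFrobenioid C₂.toElem) (H : h.StandardIsotropicNotGroupLike)
    (hs₁ : IsSlim D) (hs₂ : IsSlim D')
    (h5₁ : C₁.BsFldPreStepLimitCriterion (PreFrobenioidData.perfection hF₁))
    (h5₂ : C₂.BsFldPreStepLimitCriterion (PreFrobenioidData.perfection hF₂)) :
    h.PreservesBsFldPreSteps :=
  have hps := h.preservesPreSteps_of_isFrobenioid h34 hF₁ hF₂ H
  h.preservesBsFldPreSteps_of_C_rows hF₁ hF₂ (h.isFrobeniusCompatible_of_preservesPreSteps hF₁ hF₂ hps)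
    (h.isFrobeniusCompatible_inverse_of_preservesPreSteps hF₁ hF₂ hps) hps
    (h.preservesOTri_of_isSlim h34 hF₁ hF₂ H hs₁ hs₂) h5₁ h5₂

/-- **C38-L08 = the typed Cor. 3.8 (i), modulo the criterion C38-L05 only** (p.81 l.18–19: "Thus, we conclude
that `Ψ` preserves the base-field-theoretic morphisms"): for every pair of tempered Frobenioids (canonical monoid
vocabulary) whose model categories are Frobenioids, satisfying C38-L01, and every `Ψ` in `Cor38Hyp`, IF the
intrinsic criterion C38-L05 holds at THE perfections of `C₁`, `C₂`, then `Cor38_i` holds with L1's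
`IsFrobeniusSlim` as the vocabulary parameter: C38-L06 (i), L07, L07b, L07c all discharged.
[cite: MochizukiEtTh2009, Cor 3.8 p.80] -/
theorem cor38_i_of_criterion (hF₁ : PreFrobenioid.IsFrobenioid C₁.toElem)
    (hF₂ : PreFrobenioid.IsFrobenioid C₂.toElem) (H : h.StandardIsotropicNotGroupLike)
    (h5₁ : C₁.BsFldPreStepLimitCriterion (PreFrobenioidData.perfection hF₁))
    (h5₂ : C₂.BsFldPreStepLimitCriterion (PreFrobenioidData.perfection hF₂)) :
    Cor38_i (fun E _ => IsFrobeniusSlim E) h :=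
  h.cor38_i_of_rows
    (fun hFs hFs' =>
      h.preservesBsFldPreSteps_of_isFrobeniusSlim_of_criterion h34 hF₁ hF₂ H hFs hFs' h5₁ h5₂)
    (h.preservesFactorisation_of_isFrobenioid h34 hF₁ hF₂ H) (C₁.hasFactorisations_of_isFrobenioid hF₁)
    (C₁.bsFldOfFactorisation_of_isFrobenioid hF₁) (C₂.bsFldOfFactorisation_of_isFrobenioid hF₂)

/-- **Cor. 3.8 (ii), first conclusion, over slim bases, modulo the criterion C38-L05**: `Ψ` preserves the
base-field-theoretic morphisms (C38-L06 (ii), L07, L07b, L07c discharged). Modulo `hF_i` and C38-L01.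
[cite: MochizukiEtTh2009, Cor 3.8 p.81] -/
theorem preservesBaseFieldTheoretic_of_isSlim_of_criterion (hF₁ : PreFrobenioid.IsFrobenioid C₁.toElem)
    (hF₂ : PreFrobenioid.IsFrobenioid C₂.toElem) (H : h.StandardIsotropicNotGroupLike)
    (hs₁ : IsSlim D) (hs₂ : IsSlim D')
    (h5₁ : C₁.BsFldPreStepLimitCriterion (PreFrobenioidData.perfection hF₁))
    (h5₂ : C₂.BsFldPreStepLimitCriterion (PreFrobenioidData.perfection hF₂)) :
    PreservesBaseFieldTheoretic h :=
  h.preservesBaseFieldTheoretic_of_rows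
    (h.preservesBsFldPreSteps_of_isSlim_of_criterion h34 hF₁ hF₂ H hs₁ hs₂ h5₁ h5₂)
    (h.preservesFactorisation_of_isFrobenioid h34 hF₁ hF₂ H) (C₁.hasFactorisations_of_isFrobenioid hF₁)
    (C₁.bsFldOfFactorisation_of_isFrobenioid hF₁) (C₂.bsFldOfFactorisation_of_isFrobenioid hF₂)

/-- **C38-L10 = FACT F-2823 `InducesHullEquivalence`, instance form over slim bases, modulo the criterion
C38-L05 and Rmk. 3.6.3** (p.82 l.1–5: "it follows from the explicit description of the base-field-theoretic hull
given in Remark 3.6.3 that `Ψ` … induces an equivalence of categories `C₁^{bs-fld} ⥲ C₂^{bs-fld}`"): for every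
pair of tempered Frobenioids (canonical monoid vocabulary, SLIM bases) whose model categories are Frobenioids,
satisfying C38-L01, and every `Ψ` in `Cor38Hyp`, GIVEN the criterion C38-L05 at THE perfections and the typed
Rmk. 3.6.3 `Remark363` for `C₁`, `C₂` (FACT F-0581; `remark363_of_prop34Cnst`), `Ψ` induces a compatible
equivalence of the REAL hull categories — abc-iut-w5's derivation `inducesHullEquivalence_of_rows` with the
object clause of Rmk. 3.6.3 (`hullEssImageObjClause_holds`), hull faithfulness (`hullFaithful_holds`), C38-L02a,
L06, L08, L09 all discharged. [cite: MochizukiEtTh2009, Cor 3.8 p.82] -/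
theorem inducesHullEquivalence_of_isSlim_of_criterion (hF₁ : PreFrobenioid.IsFrobenioid C₁.toElem)
    (hF₂ : PreFrobenioid.IsFrobenioid C₂.toElem) (H : h.StandardIsotropicNotGroupLike)
    (hs₁ : IsSlim D) (hs₂ : IsSlim D')
    (h5₁ : C₁.BsFldPreStepLimitCriterion (PreFrobenioidData.perfection hF₁))
    (h5₂ : C₂.BsFldPreStepLimitCriterion (PreFrobenioidData.perfection hF₂))
    (hR₁ : C₁.Remark363) (hR₂ : C₂.Remark363) : h.InducesHullEquivalence :=
  h.inducesHullEquivalence_of_rows hR₁ hR₂ C₁.hullEssImageObjClause_holds C₂.hullEssImageObjClause_holds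
    C₁.hullFaithful_holds C₂.hullFaithful_holds (h.preservesPreSteps_of_isFrobenioid h34 hF₁ hF₂ H)
    (h.preservesFrobeniusTrivial_of_isSlim h34 hF₁ hF₂ H hs₁ hs₂)
    (h.preservesBsFldPreSteps_of_isSlim_of_criterion h34 hF₁ hF₂ H hs₁ hs₂ h5₁ h5₂)
    (h.preservesBaseFieldTheoretic_of_isSlim_of_criterion h34 hF₁ hF₂ H hs₁ hs₂ h5₁ h5₂)

/-- **The typed Cor. 3.8 (ii) over slim bases, modulo the criterion C38-L05 and Rmk. 3.6.3**, for ANY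
vocabulary parameter `IsDivSlim` (its antecedents are not needed when `D_i` are slim, [FrdI] Def. 4.5 (iv) /
Rem. 4.11.1). Modulo `hF_i` and C38-L01. [cite: MochizukiEtTh2009, Cor 3.8 p.81] -/
theorem cor38_ii_of_isSlim_of_criterion
    (IsDivSlim : ∀ (E : Type u) [Category.{v} E], (Eᵒᵖ ⥤ CommMonCat.{w}) → Prop)
    (hF₁ : PreFrobenioid.IsFrobenioid C₁.toElem) (hF₂ : PreFrobenioid.IsFrobenioid C₂.toElem)
    (H : h.StandardIsotropicNotGroupLike) (hs₁ : IsSlim D) (hs₂ : IsSlim D')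
    (h5₁ : C₁.BsFldPreStepLimitCriterion (PreFrobenioidData.perfection hF₁))
    (h5₂ : C₂.BsFldPreStepLimitCriterion (PreFrobenioidData.perfection hF₂))
    (hR₁ : C₁.Remark363) (hR₂ : C₂.Remark363) : Cor38_ii IsDivSlim h :=
  fun _ _ => ⟨h.preservesBaseFieldTheoretic_of_isSlim_of_criterion h34 hF₁ hF₂ H hs₁ hs₂ h5₁ h5₂,
    h.inducesHullEquivalence_of_isSlim_of_criterion h34 hF₁ hF₂ H hs₁ hs₂ h5₁ h5₂ hR₁ hR₂⟩

end Cor38Hyp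

end TreeMonoidVocab

section TreeCatVocab

variable {D₀ : Type u₀} [Category.{v₀} D₀] {D₀' : Type u₀} [Category.{v₀} D₀']
  {T : RealifiedDivisorMonoids (D₀ := D₀) treeMonoidVocab.{w}}
  {T' : RealifiedDivisorMonoids (D₀ := D₀') treeMonoidVocab.{w}}
  {D : Type u} [Category.{v} D] {D' : Type u} [Category.{v} D']
  {IsRational IsStrictlyRational : (Dᵒᵖ ⥤ CommMonCat.{w}) → Prop}
  {IsRational' IsStrictlyRational' : (D'ᵒᵖ ⥤ CommMonCat.{w}) → Prop}
  {C₁ : TemperedFrobenioid T D (treeCatVocab D IsRational IsStrictlyRational)}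
  {C₂ : TemperedFrobenioid T' D' (treeCatVocab D' IsRational' IsStrictlyRational')} (h : Cor38Hyp C₁ C₂)
  (h34 : FrdI.Thm34ii.{w, v, max v w, u, max u w})

namespace Cor38Hyp

include h34

/-- **F-2818 at the canonical vocabulary**: `PreservesFactorisation h` for EVERY pair of tempered Frobenioids
over the tree's [FrdI] vocabularies and every `Ψ` in `Cor38Hyp`, GIVEN only abc-iut-L2's standing residual
`hBmon_i : IsMonoidOn B_i` ([FrdI] Thm. 5.2 preamble "`B` a monoid on `D`"; it yields `hF_i` by Thm. 5.2 (ii),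
`isFrobenioid_treeCatVocab_of_isMonoidOn`, and C38-L01, `standardIsotropicNotGroupLike_treeCatVocab`).
[cite: MochizukiEtTh2009, Cor 3.8 p.81] -/
theorem preservesFactorisation_treeCatVocab (hBmon₁ : IsMonoidOn C₁.ratFnFunctor)
    (hBmon₂ : IsMonoidOn C₂.ratFnFunctor) : h.PreservesFactorisation :=
  h.preservesFactorisation_of_isFrobenioid h34 (C₁.isFrobenioid_treeCatVocab_of_isMonoidOn hBmon₁)
    (C₂.isFrobenioid_treeCatVocab_of_isMonoidOn hBmon₂)
    (h.standardIsotropicNotGroupLike_treeCatVocab hBmon₁ hBmon₂)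

/-- **F-2821 at the canonical vocabulary, slim bases**: `PreservesFrobeniusTrivial h`, GIVEN only `hBmon_i` and
"`D_i` slim". [cite: MochizukiEtTh2009, Cor 3.8 p.82] -/
theorem preservesFrobeniusTrivial_treeCatVocab_of_isSlim (hBmon₁ : IsMonoidOn C₁.ratFnFunctor)
    (hBmon₂ : IsMonoidOn C₂.ratFnFunctor) (hs₁ : IsSlim D) (hs₂ : IsSlim D') :
    h.PreservesFrobeniusTrivial :=
  h.preservesFrobeniusTrivial_of_isSlim h34 (C₁.isFrobenioid_treeCatVocab_of_isMonoidOn hBmon₁)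
    (C₂.isFrobenioid_treeCatVocab_of_isMonoidOn hBmon₂)
    (h.standardIsotropicNotGroupLike_treeCatVocab hBmon₁ hBmon₂) hs₁ hs₂

/-- **Cor. 3.8 (i) at the canonical vocabulary, modulo `hBmon_i` and the criterion C38-L05 only.**
[cite: MochizukiEtTh2009, Cor 3.8 p.80] -/
theorem cor38_i_treeCatVocab_of_criterion (hBmon₁ : IsMonoidOn C₁.ratFnFunctor)
    (hBmon₂ : IsMonoidOn C₂.ratFnFunctor)
    (h5₁ : C₁.BsFldPreStepLimitCriterion
      (PreFrobenioidData.perfection (C₁.isFrobenioid_treeCatVocab_of_isMonoidOn hBmon₁)))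
    (h5₂ : C₂.BsFldPreStepLimitCriterion
      (PreFrobenioidData.perfection (C₂.isFrobenioid_treeCatVocab_of_isMonoidOn hBmon₂))) :
    Cor38_i (fun E _ => IsFrobeniusSlim E) h :=
  h.cor38_i_of_criterion h34 _ _ (h.standardIsotropicNotGroupLike_treeCatVocab hBmon₁ hBmon₂) h5₁ h5₂

/-- **F-2823 at the canonical vocabulary, slim bases, modulo `hBmon_i`, the criterion C38-L05 and the inputs of
Rmk. 3.6.3** (Prop. 3.4 (ii) at monoid type `Λ`, `T.Prop34Cnst cnst`, and inverse-closure of `F₀^Λ`, exactly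
the hypotheses of `remark363_of_prop34Cnst`). [cite: MochizukiEtTh2009, Cor 3.8 p.82] -/
theorem inducesHullEquivalence_treeCatVocab_of_isSlim_of_criterion (hBmon₁ : IsMonoidOn C₁.ratFnFunctor)
    (hBmon₂ : IsMonoidOn C₂.ratFnFunctor) (hs₁ : IsSlim D) (hs₂ : IsSlim D')
    (h5₁ : C₁.BsFldPreStepLimitCriterion
      (PreFrobenioidData.perfection (C₁.isFrobenioid_treeCatVocab_of_isMonoidOn hBmon₁)))
    (h5₂ : C₂.BsFldPreStepLimitCriterion
      (PreFrobenioidData.perfection (C₂.isFrobenioid_treeCatVocab_of_isMonoidOn hBmon₂)))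
    {Dcnst : Type u₁} [Category.{v₁} Dcnst] {cnst : D₀ ⥤ Dcnst} {cnst' : D₀' ⥤ Dcnst}
    (hP₁ : T.Prop34Cnst cnst) (hP₂ : T'.Prop34Cnst cnst')
    (hFinv₁ : ∀ (Y : D₀ᵒᵖ) (b : T.BΛ.obj Y), b ∈ T.FΛ Y → ∃ b' ∈ T.FΛ Y, b' * b = 1)
    (hFinv₂ : ∀ (Y : D₀'ᵒᵖ) (b : T'.BΛ.obj Y), b ∈ T'.FΛ Y → ∃ b' ∈ T'.FΛ Y, b' * b = 1) :
    h.InducesHullEquivalence :=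
  h.inducesHullEquivalence_of_isSlim_of_criterion h34 _ _
    (h.standardIsotropicNotGroupLike_treeCatVocab hBmon₁ hBmon₂) hs₁ hs₂ h5₁ h5₂
    (C₁.remark363_of_prop34Cnst hP₁ hFinv₁) (C₂.remark363_of_prop34Cnst hP₂ hFinv₂)

end Cor38Hyp

end TreeCatVocab

end Literature.AnabelianGeometry.EtaleTheta
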